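import Summits.QuantumFields.YangMills.Theorems.SwapVirialDeficitBlowUpGnomonicAnisoCoercivity
import HarnessLib

/-!
# EXPLICIT LETTER SPEEDS AT THE GNOMONIC BASE POINTS: `x̂′(0) = ±(0,0,u)/√(1+x₀²)`, `ẑ′(0) = (0,z)`, `ŵ′(0) = Ā·x̂′(0)·A + x̂₀·ẑ′(0)` for the slaved
# letter `ŵ = Ā·x̂·A·ẑ`, and `(‖f‖²)″(0) = 2‖f′(0)‖²` for a path with `f(0) = 0` (free-hands support of ⟨stmt-QuantumFields-24197⟩ `SwapVirialDeficit.SwapGluedStiffness`;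
# calculus for the seam-commutator stiffness floors `[C₀,C₁]`, `[C₁,C₂]` at the END `ψ → π/2` of stub S3∕S4 «finiteness of the bottom measure»)

w2 g57's S-B files (✓`hasDerivAt_leader_zero`, ✓`hasDerivAt_slavedLetter`, …) bound the letter speeds along the blow-up by `1` but do not name their values; the
Hessian floors of the commutator relations `[C₀,C₁] = [x̂, Āx̂Aẑ]`, `[C₁,C₂]` at a flat base point are `2‖f′(0)‖²`-type quantities (`f` = the commutator path,
`f(0) = 0`), so the VALUES of the speeds are needed:
* §1 `hasDerivAt_radialUnit_ray_orth` — `X ≠ 0`, `⟪X, U⟫ = 0` ⟹ `(s ↦ ν(X + sU))′(0) = U/‖X‖` (lit ✓`hasFDerivAt_radialUnit`, ✓`tangentialProj_eq_self`);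
* §2 the gnomonic letters along fibre rays are AFFINE: `gnoLetter_axial_ray`, `gnoLetter_smul_ray`; orthogonality (lit ✓`DST24CriticalPoint.inner_eq_components` not imported — two `simp`s) `inner_axial_transverse`, `inner_one_pure`; the norm
  `norm_gnoLetter_axial`;
* §3 ★ `hasDerivAt_xhat_ray` (`x̂′(0) = (√(1+c²))⁻¹·(±(0,0,u₀,u₁))`, the pure quaternion written `(gnomonicQuat (0,u₀,u₁)).im`), ★ `hasDerivAt_zhat_ray` (`ẑ′(0) = (0, z) = (gnomonicQuat z).im`), ★ `hasDerivAt_slaved_ray` (product rule for `Ā·x̂(s)·A·ẑ(s)`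
  at a point where `ẑ(0) = 1`);
* §4 ★ `iteratedDeriv_two_norm_sq_of_zero` — `f : ℝ → ℍ` of class `C²` with `f 0 = 0` ⟹ `iteratedDeriv 2 (‖f ·‖²) 0 = 2‖deriv f 0‖²`.

HONEST LABEL: calculus bookkeeping; S3∕S4∕S5, ⟨24197⟩ ∕ ⟨24194⟩ ∕ ⟨24497⟩ OPEN; own crux ⟨22884⟩ OPEN (blocked-on ⟨19935⟩); the Yang–Mills mass gap is NOT proved; no
summit is proved by a line.  THEOREMS ONLY (0 `def`, 0 `sorry`), standard axioms.  Width seat ym-line-sfw-p2-w3 g66 (cell ym-idea-1, free hands),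
`--supports stmt-QuantumFields-24197`.  References: [folklore].
-/

set_option autoImplicit false

noncomputable section

open Quaternion
open scoped Quaternion RealInnerProductSpace ContDiff
open Literature.Analysis.Calculus (radialUnit radialUnit_def norm_radialUnit tangentialProj tangentialProj_eq_self hasFDerivAt_radialUnit)
open Literature.MathematicalPhysics.QuantumLattice (gnomonicQuat)

namespace Summit.QuantumFields.YangMills.Theorems.SwapVirialDeficit.BlowUpRing

variable {L : ℕ}

/-! ## §1 The radial projection along a ray orthogonal to the base point -/

/-- ★ For `X ≠ 0` and `U ⊥ X`: `(s ↦ ν(X + s·U))` has derivative `‖X‖⁻¹·U` at `s = 0`. [folklore] -/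
theorem hasDerivAt_radialUnit_ray_orth {X U : ℍ} (hX : X ≠ 0) (h : ⟪X, U⟫ = 0) :
    HasDerivAt (fun s : ℝ => radialUnit (X + s • U)) (‖X‖⁻¹ • U) 0 := by
  have h1 : HasDerivAt (fun s : ℝ => X + s • U) U 0 := by
    simpa using ((hasDerivAt_id (0 : ℝ)).smul_const U).const_add X
  have h2 := hasFDerivAt_radialUnit (E := ℍ) (x := X + (0 : ℝ) • U) (by simpa using hX)
  have h3 := h2.comp_hasDerivAt (0 : ℝ) h1
  simp only [zero_smul, add_zero] at h3
  have h4 : (‖X‖⁻¹ • tangentialProj X) U = ‖X‖⁻¹ • U := by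
    rw [FunLike.coe_smul, Pi.smul_apply, tangentialProj_eq_self h]
  rw [h4] at h3
  exact h3

/-! ## §2 The letters along fibre rays are affine; orthogonality; norms -/

/-- An axial letter plus a transverse displacement, through `gnoLetter`: `gnoLetter ε ((c,0,0) + s·(0,u₀,u₁)) = gnoLetter ε (c,0,0) + s·(±(0,0,u₀,u₁))`. [folklore] -/
theorem gnoLetter_axial_ray (ε : Bool) (c u₀ u₁ s : ℝ) :
    gnoLetter ε ((![c, 0, 0] : Fin 3 → ℝ) + s • ![0, u₀, u₁]) = gnoLetter ε ![c, 0, 0] + s • (gnoSign ε • (gnomonicQuat ![0, u₀, u₁]).im) := by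
  rw [gnoLetter_eq, gnoLetter_eq]
  ext <;> simp [gnomonicQuat] <;> ring

/-- The positive letter over a ray through the origin: `gnoLetter true (s·z) = 1 + s·(0, z)`. [folklore] -/
theorem gnoLetter_smul_ray (s : ℝ) (z : Fin 3 → ℝ) :
    gnoLetter true (s • z) = (1 : ℍ) + s • (gnomonicQuat z).im := by
  rw [gnoLetter_eq]
  have h1 : gnoSign true = 1 := rfl
  rw [h1, one_smul]
  ext <;> simp [gnomonicQuat]

/-- The axial letter is orthogonal to the transverse displacement. [folklore] -/
theorem inner_axial_transverse (ε : Bool) (c u₀ u₁ : ℝ) : ⟪gnoLetter ε ![c, 0, 0], gnoSign ε • (gnomonicQuat ![0, u₀, u₁]).im⟫ = 0 := by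
  rw [Quaternion.inner_def, Quaternion.re_mul, gnoLetter_eq]
  simp [gnomonicQuat]

/-- `1 ⊥ (0, z)`. [folklore] -/
theorem inner_one_pure (z : Fin 3 → ℝ) : ⟪(1 : ℍ), (gnomonicQuat z).im⟫ = 0 := by
  rw [Quaternion.inner_def, Quaternion.re_mul]; simp

/-- `‖gnoLetter ε (c,0,0)‖ = √(1 + c²)`. [folklore] -/
theorem norm_gnoLetter_axial (ε : Bool) (c : ℝ) : ‖gnoLetter ε ![c, 0, 0]‖ = Real.sqrt (1 + c ^ 2) := by
  have h := norm_sq_gnoLetter ε ![c, 0, 0]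
  have hn : Gnomonic.normSq3 ![c, 0, 0] = c ^ 2 := by
    simp [Gnomonic.normSq3, Fin.sum_univ_three]
  rw [hn] at h
  rw [← h, Real.sqrt_sq (norm_nonneg _)]

/-! ## §3 The letter speeds at the base point -/

/-- ★ **The speed of the axial letter `x̂` along a transverse fibre ray**: `x̂′(0) = (√(1+c²))⁻¹·(±(0,0,u₀,u₁))`. [folklore] -/
theorem hasDerivAt_xhat_ray (ε : Bool) (c u₀ u₁ : ℝ) :
    HasDerivAt (fun s : ℝ => radialUnit (gnoLetter ε ((![c, 0, 0] : Fin 3 → ℝ) + s • ![0, u₀, u₁])))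
      ((Real.sqrt (1 + c ^ 2))⁻¹ • (gnoSign ε • (gnomonicQuat ![0, u₀, u₁]).im)) 0 := by
  have e : (fun s : ℝ => radialUnit (gnoLetter ε ((![c, 0, 0] : Fin 3 → ℝ) + s • ![0, u₀, u₁]))) =
      fun s : ℝ => radialUnit (gnoLetter ε ![c, 0, 0] + s • (gnoSign ε • (gnomonicQuat ![0, u₀, u₁]).im)) := funext fun s => by rw [gnoLetter_axial_ray]
  rw [e, ← norm_gnoLetter_axial ε c]
  exact hasDerivAt_radialUnit_ray_orth (gnoLetter_ne_zero ε _) (inner_axial_transverse ε c u₀ u₁)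

/-- ★ **The speed of the positive letter `ẑ` along a ray through the reference**: `ẑ′(0) = (0, z)`. [folklore] -/
theorem hasDerivAt_zhat_ray (z : Fin 3 → ℝ) :
    HasDerivAt (fun s : ℝ => radialUnit (gnoLetter true (s • z))) (gnomonicQuat z).im 0 := by
  have e : (fun s : ℝ => radialUnit (gnoLetter true (s • z))) = fun s : ℝ => radialUnit ((1 : ℍ) + s • (gnomonicQuat z).im) :=
    funext fun s => by rw [gnoLetter_smul_ray]
  rw [e]
  have h := hasDerivAt_radialUnit_ray_orth (X := (1 : ℍ)) (U := (gnomonicQuat z).im) one_ne_zero (inner_one_pure z)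
  rwa [norm_one, inv_one, one_smul] at h

/-- ★ **The speed of the slaved letter** `ŵ(s) = Ā·x̂(s)·A·ẑ(s)`: if `x̂′(0) = X′`, `ẑ′(0) = Z′`, `ẑ(0) = 1` and `Ā·x̂(0)·A = x̂(0)` (axial base letter, axial unit hub), then
`ŵ′(0) = Ā·X′·A + x̂(0)·Z′`. [folklore] -/
theorem hasDerivAt_slaved_ray {xh zh : ℝ → ℍ} {X' Z' A : ℍ} (hx : HasDerivAt xh X' 0) (hz : HasDerivAt zh Z' 0) (hz0 : zh 0 = 1)
    (hAx : star A * xh 0 * A = xh 0) :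
    HasDerivAt (fun s : ℝ => star A * xh s * A * zh s) (star A * X' * A + xh 0 * Z') 0 := by
  have h1 : HasDerivAt (fun s : ℝ => star A * xh s * A) (star A * X' * A) 0 := by
    have := (hx.const_mul (star A)).mul_const A
    simpa [mul_assoc] using this
  have h2 := h1.mul hz
  rw [hz0, mul_one, hAx] at h2
  exact h2

/-! ## §4 The second derivative of a squared norm at a zero -/

/-- ★ **`(‖f‖²)″(0) = 2‖f′(0)‖²` for a `C²` quaternion path with `f(0) = 0`.** [folklore] -/
theorem iteratedDeriv_two_norm_sq_of_zero {f : ℝ → ℍ} (hf : ContDiff ℝ 2 f) (h0 : f 0 = 0) :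
    iteratedDeriv 2 (fun s => ‖f s‖ ^ 2) 0 = 2 * ‖deriv f 0‖ ^ 2 := by
  have hf1 : Differentiable ℝ f := hf.differentiable (by norm_num)
  have hf2 : Differentiable ℝ (deriv f) := hf.differentiable_deriv_two
  -- first derivative everywhere: `2⟪f, f′⟫`
  have hd1 : ∀ s, HasDerivAt (fun s => ‖f s‖ ^ 2) (2 * ⟪f s, deriv f s⟫) s := by
    intro s
    have h := (hf1 s).hasDerivAt
    have := h.norm_sq
    simpa using this
  have e1 : deriv (fun s => ‖f s‖ ^ 2) = fun s => 2 * ⟪f s, deriv f s⟫ := funext fun s => (hd1 s).deriv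
  rw [iteratedDeriv_succ, iteratedDeriv_one, e1]
  -- second derivative at `0`
  have h2 : HasDerivAt (fun s => ⟪f s, deriv f s⟫) (⟪f 0, deriv (deriv f) 0⟫ + ⟪deriv f 0, deriv f 0⟫) 0 :=
    ((hf1 0).hasDerivAt).inner ℝ ((hf2 0).hasDerivAt)
  have h3 : HasDerivAt (fun s => 2 * ⟪f s, deriv f s⟫) (2 * (⟪f 0, deriv (deriv f) 0⟫ + ⟪deriv f 0, deriv f 0⟫)) 0 := h2.const_mul 2
  rw [h3.deriv, h0, inner_zero_left, zero_add, real_inner_self_eq_norm_sq]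

end Summit.QuantumFields.YangMills.Theorems.SwapVirialDeficit.BlowUpRing

end
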